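import Mathlib.Combinatorics.SimpleGraph.CycleGraph
import Literature.Probability.LatticeModels.HardCoreSpatialMixingProofs
import HarnessLib

/-!
# Vacancy decay in the hard-core model: prescribing `k` vertices EMPTY costs a factor `ρ^k`

Setting and vocabulary: the hard-core model with a boundary condition of the companion files
`HardCoreSpatialMixing` / `HardCoreSpatialMixingProofs` — `hardCoreZ G λ Λ R = ∑ λ^{|I|}` over the
independent sets `I` of the finite graph `G` with `I ∩ Λ = R` [cite: Weitz2006, §2].  Weitz's tree
recursion for the occupation ratio of a free vertex, `R_v = λ ∏_u (1 + R_u)^{-1}` over the free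
neighbours `u` with `R_u ≤ λ` [cite: Weitz2006, §2 and Thm. 3.1 (proof)] (in the tree:
`Weitz.ratio_eq_mul_prod`, `Weitz.ratio_le`), gives the uniform LOWER bound `R_v ≥ λ/(1+λ)^{deg v}`
whatever vertices are prescribed vacant elsewhere, i.e. the conditional probability that `v` is VACANT
given that a set `S'` of other vertices is vacant is at most
`ρ_Δ(λ) := (1+λ)^Δ / ((1+λ)^Δ + λ)` (`deg v ≤ Δ`).  We prove this consequence directly (no tree
recursion: strip `I ∩ N(v)`, `hardCoreZ_le_pow_mul_strip`) and iterate it: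

* `hardCoreZ_vacant_le` — for EVERY finite set `S` of vertices of degree `≤ Δ` (no separation
  hypothesis on `S`) and every `λ > 0`,
  `hardCoreZ G λ S ∅ ≤ ρ_Δ(λ)^{#S} · hardCoreZ G λ ∅ ∅`
  (the weight of the independent sets avoiding `S` is an exponentially small fraction of the total);
* `hardCoreZ_vacant_le_indep` — the same against `independencePolynomial G λ`;
* `cycle_hardCoreZ_vacant_le` — the cycle `C_N` (`SimpleGraph.cycleGraph (n+3)`, all degrees `2`) at
  fugacity `λ = 2`: `ρ = 9/11`, `hardCoreZ (cycleGraph (n+3)) 2 S ∅ ≤ (9/11)^{#S} · hardCoreZ … ∅ ∅`.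

CONDITIONAL (two-sided boundary) form, §`Conditional` below: for a boundary condition `(Λ, R)`
(`R ⊆ Λ` occupied, `Λ ∖ R` vacant) and a set `U` disjoint from `Λ` none of whose vertices is adjacent to
an occupied boundary vertex, `hardCoreZ G λ (Λ ∪ U) R ≤ ρ_Δ(λ)^{#U} · hardCoreZ G λ Λ R`
(`hardCoreZ_union_vacant_le_bc`; one-vertex step `hardCoreZ_insert_vacant_le_bc`, strip lemma
`hardCoreZ_le_pow_mul_strip_bc`), the version for arbitrary `U` disjoint from `Λ` with the exponent
counting only the vertices of `U` without an occupied boundary neighbour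
(`hardCoreZ_union_vacant_le_bc'`), and the cycle at fugacity `2` (`cycle_hardCoreZ_union_vacant_le_bc`):
conditionally on ANY configuration of the coin process on a set `A`, a set `U` of further positions is
coin-free with probability at most `(9/11)^{#U − #(vertices of U next to a coin of A)}` — the two-sided
Markov / conditional vacancy bound asked for by the cell (planner qa-qnc0-p1 g32, K-58(d)).

SINGLE SITE, TWO-SIDED (§`Two-sided single-site bounds`): at a free vertex with no occupied prescribed
neighbour, `1 − ρ_Δ(λ) ≤ p_v ≤ λ/(1+λ)` (`one_sub_vacancyRatio_le_hardCoreOccProb`,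
`hardCoreOccProb_le_activity_div` — the upper bound needs only `v ∉ Λ ⊇ R`); on `C_N` at fugacity `2`,
`p_v ∈ [2/11, 2/3]` (`cycle_hardCoreOccProb_mem_Icc`; planner qa-qnc0-p1 g33, L-33(b) / (W-c)).

Application (Summits side, cell qa-qnc0 ROUND-30 §4 `HMixC`, not here): the zero set ("coins") of the
kernel line of a uniformly random odd input of the mod-3 ring game is hard-core distributed on `C_N` with
fugacity `2` (`KernelFibration.card_fibre`), so at most `(9/11)^{#S}·2^{N−1} + 1` odd inputs have all
positions of a prescribed set `S` active.  Everything here is PROVED; no named facts.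
-/

namespace Literature.Probability.LatticeModels

namespace HardCoreVacancy

open Finset Weitz

variable {V : Type*} [Fintype V] [DecidableEq V] (G : SimpleGraph V) [DecidableRel G.Adj]

/-- `hardCoreZ` with the all-vacant boundary condition as a sum over a filtered set.
[cite: Weitz2006, §2 (definition of the restricted partition function)] -/
theorem hardCoreZ_vacant_eq_sum_filter (lam : ℝ) (Λ : Finset V) :
    hardCoreZ G lam Λ ∅ =
      ∑ I ∈ univ.filter (fun I : Finset V => G.IsIndepSet (I : Set V) ∧ I ∩ Λ = ∅), lam ^ I.card := by
  unfold hardCoreZ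
  rw [sum_filter]

/-- **Stripping the neighbourhood of a vertex.**  Splitting `I = (I ∩ N(v)) ⊔ (I ∖ N(v))` gives
`Z^{Λ,∅} ≤ (1+λ)^{deg v} · Z^{Λ ∪ N(v),∅}` (used with `v ∈ Λ`, i.e. `v` prescribed vacant).
[cite: Weitz2006, Thm. 3.1 (proof: `Z_G(v occupied) = λ·Z_{G−N[v]}`, the companion bound for `v` vacant supplied here)] -/
theorem hardCoreZ_le_pow_mul_strip {lam : ℝ} (hlam : 0 ≤ lam) (Λ : Finset V) (v : V) :
    hardCoreZ G lam Λ ∅ ≤ (1 + lam) ^ G.degree v * hardCoreZ G lam (Λ ∪ G.neighborFinset v) ∅ := by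
  classical
  set A := univ.filter (fun I : Finset V => G.IsIndepSet (I : Set V) ∧ I ∩ Λ = ∅) with hA
  set B := univ.filter (fun J : Finset V => G.IsIndepSet (J : Set V) ∧ J ∩ (Λ ∪ G.neighborFinset v) = ∅)
    with hB
  set P := (G.neighborFinset v).powerset with hP
  -- the weight on pairs
  let w : Finset V × Finset V → ℝ := fun p => lam ^ p.1.card * lam ^ p.2.card
  -- (1+λ)^{deg v} = Σ_{T ⊆ N(v)} λ^{|T|}
  have hbinom : (1 + lam) ^ G.degree v = ∑ T ∈ P, lam ^ T.card := by
    rw [← G.card_neighborFinset_eq_degree v, hP, add_comm, ← sum_pow_mul_eq_add_pow lam 1 (G.neighborFinset v)]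
    refine sum_congr rfl fun T _ => ?_
    rw [one_pow, mul_one]
  -- RHS as a sum over the product
  have hrhs : (1 + lam) ^ G.degree v * hardCoreZ G lam (Λ ∪ G.neighborFinset v) ∅ = ∑ p ∈ P ×ˢ B, w p := by
    rw [hbinom, hardCoreZ_vacant_eq_sum_filter, ← hB, sum_product, sum_mul]
    refine sum_congr rfl fun T _ => ?_
    rw [mul_sum]
  -- LHS as the sum of `w ∘ φ` with `φ I = (I ∩ N(v), I \ N(v))`
  let φ : Finset V → Finset V × Finset V := fun I => (I ∩ G.neighborFinset v, I \ G.neighborFinset v)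
  have hlhs : hardCoreZ G lam Λ ∅ = ∑ I ∈ A, w (φ I) := by
    rw [hardCoreZ_vacant_eq_sum_filter, ← hA]
    refine sum_congr rfl fun I _ => ?_
    show lam ^ I.card = lam ^ (I ∩ G.neighborFinset v).card * lam ^ (I \ G.neighborFinset v).card
    rw [← pow_add, card_inter_add_card_sdiff]
  have hinj : Set.InjOn φ A := by
    intro I _ J _ hIJ
    have h1 : I ∩ G.neighborFinset v = J ∩ G.neighborFinset v := congrArg Prod.fst hIJ
    have h2 : I \ G.neighborFinset v = J \ G.neighborFinset v := congrArg Prod.snd hIJ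
    rw [← sdiff_union_inter I (G.neighborFinset v), ← sdiff_union_inter J (G.neighborFinset v), h1, h2]
  have himage : A.image φ ⊆ P ×ˢ B := by
    intro p hp
    rw [mem_image] at hp
    obtain ⟨I, hI, rfl⟩ := hp
    rw [hA, mem_filter] at hI
    obtain ⟨-, hind, hIΛ⟩ := hI
    rw [mem_product]
    refine ⟨?_, ?_⟩
    · rw [hP, mem_powerset]; exact inter_subset_right
    · rw [hB, mem_filter]
      refine ⟨mem_univ _, hind.mono (by intro x hx; exact (mem_sdiff.1 hx).1), ?_⟩
      rw [inter_union_distrib_left]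
      apply union_eq_empty.2
      constructor
      · rw [← subset_empty, ← hIΛ]
        exact inter_subset_inter sdiff_subset (Subset.refl _)
      · exact sdiff_inter_self _ _
  calc hardCoreZ G lam Λ ∅ = ∑ I ∈ A, w (φ I) := hlhs
    _ = ∑ p ∈ A.image φ, w p := (sum_image hinj).symm
    _ ≤ ∑ p ∈ P ×ˢ B, w p :=
        sum_le_sum_of_subset_of_nonneg himage fun p _ _ => by positivity
    _ = (1 + lam) ^ G.degree v * hardCoreZ G lam (Λ ∪ G.neighborFinset v) ∅ := hrhs.symm

/-- The vacancy-decay ratio `ρ_Δ(λ) = (1+λ)^Δ / ((1+λ)^Δ + λ)`: an upper bound for the conditional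
probability that a vertex of degree `≤ Δ` is vacant given any set of other vertices vacant.
[cite: Weitz2006, §2 and Thm. 3.1 (tree recursion `R_v = λ∏(1+R_u)^{-1}`, `R_u ≤ λ`; the bound `1/(1+R_v) ≤ ρ_Δ` supplied here)] -/
noncomputable def vacancyRatio (Δ : ℕ) (lam : ℝ) : ℝ := (1 + lam) ^ Δ / ((1 + lam) ^ Δ + lam)

/-- `ρ_Δ(λ) ≥ 0` for `λ ≥ 0`. [cite: Weitz2006, §2 (setting); elementary] -/
theorem vacancyRatio_nonneg (Δ : ℕ) {lam : ℝ} (hlam : 0 ≤ lam) : 0 ≤ vacancyRatio Δ lam := by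
  unfold vacancyRatio; positivity

/-- `ρ_Δ(λ) < 1` for `λ > 0`. [cite: Weitz2006, §2 (setting); elementary] -/
theorem vacancyRatio_lt_one (Δ : ℕ) {lam : ℝ} (hlam : 0 < lam) : vacancyRatio Δ lam < 1 := by
  unfold vacancyRatio
  rw [div_lt_one (by positivity)]
  linarith

/-- `ρ_2(2) = 9/11` (the cycle at fugacity `2`). [cite: Weitz2006, §2 (setting); arithmetic] -/
theorem vacancyRatio_two_two : vacancyRatio 2 2 = 9 / 11 := by
  unfold vacancyRatio; norm_num

/-- **One-vertex vacancy step.**  For `v ∉ S'` of degree `≤ Δ` and `λ > 0`: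
`Z^{S'∪{v},∅} ≤ ρ_Δ(λ) · Z^{S',∅}` — the conditional probability that `v` is vacant given `S'`
vacant is at most `ρ_Δ(λ)`, for ANY `S'`.
[cite: Weitz2006, Thm. 3.1 (proof; recursion for the occupation ratio) — consequence supplied here] -/
theorem hardCoreZ_insert_vacant_le {lam : ℝ} (hlam : 0 < lam) {Δ : ℕ} {S' : Finset V} {v : V}
    (hv : v ∉ S') (hdeg : G.degree v ≤ Δ) :
    hardCoreZ G lam (insert v S') ∅ ≤ vacancyRatio Δ lam * hardCoreZ G lam S' ∅ := by
  have hR : (∅ : Finset V) ⊆ S' := empty_subset _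
  have hsplit := hardCoreZ_split G (lam := lam) hv hR
  have hocc : hardCoreZ G lam (insert v S') (insert v ∅) =
      lam * hardCoreZ G lam (insert v S' ∪ G.neighborFinset v) ∅ :=
    hardCoreZ_insert_insert_eq_mul G hv hR (by simp)
  have hstrip := hardCoreZ_le_pow_mul_strip G hlam.le (insert v S') v
  set a := hardCoreZ G lam (insert v S') ∅
  set b := hardCoreZ G lam (insert v S' ∪ G.neighborFinset v) ∅
  set M := (1 + lam) ^ Δ with hM
  have hb : 0 ≤ b := hardCoreZ_nonneg G hlam.le _ _
  have hMpos : 0 < M := by positivity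
  have hpow : (1 + lam) ^ G.degree v ≤ M := pow_le_pow_right₀ (by linarith) hdeg
  have haM : a ≤ M * b := hstrip.trans (mul_le_mul_of_nonneg_right hpow hb)
  have htot : hardCoreZ G lam S' ∅ = a + lam * b := by rw [hsplit, hocc]
  -- a (M + λ) ≤ M (a + λ b)
  have key : a * (M + lam) ≤ M * (a + lam * b) := by nlinarith
  unfold vacancyRatio
  rw [← hM, htot, div_mul_eq_mul_div, le_div_iff₀ (by positivity)]
  linarith

/-- **Vacancy decay.**  For every finite set `S` of vertices of degree `≤ Δ` (no separation
hypothesis) and `λ > 0`, the independent sets avoiding `S` carry at most a `ρ_Δ(λ)^{#S}` fraction of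
the hard-core weight: `Z^{S,∅} ≤ ρ_Δ(λ)^{#S} · Z^{∅,∅}`.
[cite: Weitz2006, §2 and Thm. 3.1 (proof) — iterated consequence supplied here] -/
theorem hardCoreZ_vacant_le {lam : ℝ} (hlam : 0 < lam) {Δ : ℕ} :
    ∀ S : Finset V, (∀ v ∈ S, G.degree v ≤ Δ) →
      hardCoreZ G lam S ∅ ≤ vacancyRatio Δ lam ^ S.card * hardCoreZ G lam ∅ ∅ := by
  intro S
  induction S using Finset.induction_on with
  | empty => intro _; simp
  | @insert v S' hv ih =>
    intro hdeg
    have h1 := hardCoreZ_insert_vacant_le G hlam hv (hdeg v (mem_insert_self v S'))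
    have h2 := ih fun u hu => hdeg u (mem_insert_of_mem hu)
    have hρ := vacancyRatio_nonneg Δ hlam.le
    rw [card_insert_of_notMem hv, pow_succ]
    calc hardCoreZ G lam (insert v S') ∅ ≤ vacancyRatio Δ lam * hardCoreZ G lam S' ∅ := h1
      _ ≤ vacancyRatio Δ lam * (vacancyRatio Δ lam ^ S'.card * hardCoreZ G lam ∅ ∅) :=
          mul_le_mul_of_nonneg_left h2 hρ
      _ = vacancyRatio Δ lam ^ S'.card * vacancyRatio Δ lam * hardCoreZ G lam ∅ ∅ := by ring

/-- Vacancy decay against the independence polynomial `∑_{I independent} λ^{|I|}`.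
[cite: Weitz2006, §2 and Thm. 3.1 (proof) — iterated consequence supplied here] -/
theorem hardCoreZ_vacant_le_indep {lam : ℝ} (hlam : 0 < lam) {Δ : ℕ} (S : Finset V)
    (hdeg : ∀ v ∈ S, G.degree v ≤ Δ) :
    hardCoreZ G lam S ∅ ≤ vacancyRatio Δ lam ^ S.card * independencePolynomial G lam := by
  rw [← hardCoreZ_empty G lam]
  exact hardCoreZ_vacant_le G hlam S hdeg

/-- Uniform-degree form: in a graph of maximum degree `≤ Δ`, every `S`.
[cite: Weitz2006, §2 and Thm. 3.1 (proof) — iterated consequence supplied here] -/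
theorem hardCoreZ_vacant_le_of_maxDegree {lam : ℝ} (hlam : 0 < lam) {Δ : ℕ} (hG : G.maxDegree ≤ Δ)
    (S : Finset V) : hardCoreZ G lam S ∅ ≤ vacancyRatio Δ lam ^ S.card * hardCoreZ G lam ∅ ∅ :=
  hardCoreZ_vacant_le G hlam S fun v _ => (G.degree_le_maxDegree v).trans hG

/-- **The cycle at fugacity 2** (the law of the coin set of the mod-3 ring game): for every set `S`
of vertices of `C_N`, `N ≥ 3`, the independent sets avoiding `S` weigh at most `(9/11)^{#S}` of the
total `∑_I 2^{|I|}`.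
[cite: Weitz2006, §2 and Thm. 3.1 (proof) — specialisation supplied here] -/
theorem cycle_hardCoreZ_vacant_le (n : ℕ) (S : Finset (Fin (n + 3))) :
    hardCoreZ (SimpleGraph.cycleGraph (n + 3)) 2 S ∅ ≤
      (9 / 11 : ℝ) ^ S.card * hardCoreZ (SimpleGraph.cycleGraph (n + 3)) 2 ∅ ∅ := by
  rw [← vacancyRatio_two_two]
  exact hardCoreZ_vacant_le (SimpleGraph.cycleGraph (n + 3)) (by norm_num) S
    fun v _ => (SimpleGraph.cycleGraph_degree_three_le (v := v)).le

/-! ### Conditional (two-sided boundary) vacancy decay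

The same three steps under an arbitrary boundary condition `(Λ, R)`: the configuration on `Λ` is
prescribed to be `R` (`R ⊆ Λ` occupied, `Λ ∖ R` vacant).  The only new requirement is that the vertex
made vacant has no OCCUPIED boundary neighbour (such a vertex is vacant with conditional probability `1`,
so no decay can be claimed for it). -/

section Conditional

/-- `hardCoreZ` under the boundary condition `(Λ, R)` as a sum over a filtered set.
[cite: Weitz2006, §2 (definition of the restricted partition function)] -/
theorem hardCoreZ_eq_sum_filter (lam : ℝ) (Λ R : Finset V) :
    hardCoreZ G lam Λ R =
      ∑ I ∈ univ.filter (fun I : Finset V => G.IsIndepSet (I : Set V) ∧ I ∩ Λ = R), lam ^ I.card := by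
  unfold hardCoreZ
  rw [sum_filter]

/-- **Stripping the neighbourhood of a vertex, boundary condition `(Λ, R)`.**  If no occupied boundary
vertex is adjacent to `v`, then `Z^{Λ,R} ≤ (1+λ)^{deg v} · Z^{Λ ∪ N(v),R}`.
[cite: Weitz2006, Thm. 3.1 (proof: `Z_G(v occupied) = λ·Z_{G−N[v]}`; companion bound supplied here)] -/
theorem hardCoreZ_le_pow_mul_strip_bc {lam : ℝ} (hlam : 0 ≤ lam) {Λ R : Finset V} {v : V}
    (hadj : ¬ ∃ u ∈ R, G.Adj v u) :
    hardCoreZ G lam Λ R ≤ (1 + lam) ^ G.degree v * hardCoreZ G lam (Λ ∪ G.neighborFinset v) R := by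
  classical
  -- `R` misses `N(v)`
  have hRN : R ∩ G.neighborFinset v = ∅ := by
    apply eq_empty_of_forall_notMem
    intro u hu
    rw [mem_inter, SimpleGraph.mem_neighborFinset] at hu
    exact hadj ⟨u, hu.1, hu.2⟩
  set A := univ.filter (fun I : Finset V => G.IsIndepSet (I : Set V) ∧ I ∩ Λ = R) with hA
  set B := univ.filter (fun J : Finset V => G.IsIndepSet (J : Set V) ∧ J ∩ (Λ ∪ G.neighborFinset v) = R)
    with hB
  set P := (G.neighborFinset v).powerset with hP
  let w : Finset V × Finset V → ℝ := fun p => lam ^ p.1.card * lam ^ p.2.card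
  have hbinom : (1 + lam) ^ G.degree v = ∑ T ∈ P, lam ^ T.card := by
    rw [← G.card_neighborFinset_eq_degree v, hP, add_comm, ← sum_pow_mul_eq_add_pow lam 1 (G.neighborFinset v)]
    refine sum_congr rfl fun T _ => ?_
    rw [one_pow, mul_one]
  have hrhs : (1 + lam) ^ G.degree v * hardCoreZ G lam (Λ ∪ G.neighborFinset v) R = ∑ p ∈ P ×ˢ B, w p := by
    rw [hbinom, hardCoreZ_eq_sum_filter, ← hB, sum_product, sum_mul]
    refine sum_congr rfl fun T _ => ?_
    rw [mul_sum]
  let φ : Finset V → Finset V × Finset V := fun I => (I ∩ G.neighborFinset v, I \ G.neighborFinset v)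
  have hlhs : hardCoreZ G lam Λ R = ∑ I ∈ A, w (φ I) := by
    rw [hardCoreZ_eq_sum_filter, ← hA]
    refine sum_congr rfl fun I _ => ?_
    show lam ^ I.card = lam ^ (I ∩ G.neighborFinset v).card * lam ^ (I \ G.neighborFinset v).card
    rw [← pow_add, card_inter_add_card_sdiff]
  have hinj : Set.InjOn φ A := by
    intro I _ J _ hIJ
    have h1 : I ∩ G.neighborFinset v = J ∩ G.neighborFinset v := congrArg Prod.fst hIJ
    have h2 : I \ G.neighborFinset v = J \ G.neighborFinset v := congrArg Prod.snd hIJ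
    rw [← sdiff_union_inter I (G.neighborFinset v), ← sdiff_union_inter J (G.neighborFinset v), h1, h2]
  have himage : A.image φ ⊆ P ×ˢ B := by
    intro p hp
    rw [mem_image] at hp
    obtain ⟨I, hI, rfl⟩ := hp
    rw [hA, mem_filter] at hI
    obtain ⟨-, hind, hIΛ⟩ := hI
    rw [mem_product]
    refine ⟨?_, ?_⟩
    · rw [hP, mem_powerset]; exact inter_subset_right
    · rw [hB, mem_filter]
      refine ⟨mem_univ _, hind.mono (by intro x hx; exact (mem_sdiff.1 hx).1), ?_⟩
      rw [inter_union_distrib_left, sdiff_inter_self, union_empty]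
      -- `(I \ N(v)) ∩ Λ = (I ∩ Λ) \ N(v) = R \ N(v) = R`
      rw [sdiff_inter_right_comm, hIΛ, Finset.sdiff_eq_self_iff_disjoint, disjoint_iff_inter_eq_empty]
      exact hRN
  calc hardCoreZ G lam Λ R = ∑ I ∈ A, w (φ I) := hlhs
    _ = ∑ p ∈ A.image φ, w p := (sum_image hinj).symm
    _ ≤ ∑ p ∈ P ×ˢ B, w p :=
        sum_le_sum_of_subset_of_nonneg himage fun p _ _ => by positivity
    _ = (1 + lam) ^ G.degree v * hardCoreZ G lam (Λ ∪ G.neighborFinset v) R := hrhs.symm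

/-- **One-vertex conditional vacancy step.**  For a boundary condition `(S', R)`, a vertex `v ∉ S'`
of degree `≤ Δ` with no occupied boundary neighbour, and `λ > 0`:
`Z^{S'∪{v},R} ≤ ρ_Δ(λ) · Z^{S',R}` — the conditional probability that `v` is vacant, given the
boundary condition, is at most `ρ_Δ(λ)`.
[cite: Weitz2006, Thm. 3.1 (proof; recursion for the occupation ratio) — consequence supplied here] -/
theorem hardCoreZ_insert_vacant_le_bc {lam : ℝ} (hlam : 0 < lam) {Δ : ℕ} {S' R : Finset V} {v : V}
    (hv : v ∉ S') (hR : R ⊆ S') (hadj : ¬ ∃ u ∈ R, G.Adj v u) (hdeg : G.degree v ≤ Δ) :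
    hardCoreZ G lam (insert v S') R ≤ vacancyRatio Δ lam * hardCoreZ G lam S' R := by
  have hsplit := hardCoreZ_split G (lam := lam) hv hR
  have hocc : hardCoreZ G lam (insert v S') (insert v R) =
      lam * hardCoreZ G lam (insert v S' ∪ G.neighborFinset v) R :=
    hardCoreZ_insert_insert_eq_mul G hv hR hadj
  have hstrip := hardCoreZ_le_pow_mul_strip_bc G hlam.le (Λ := insert v S') (R := R) (v := v) hadj
  set a := hardCoreZ G lam (insert v S') R
  set b := hardCoreZ G lam (insert v S' ∪ G.neighborFinset v) R
  set M := (1 + lam) ^ Δ with hM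
  have hb : 0 ≤ b := hardCoreZ_nonneg G hlam.le _ _
  have hMpos : 0 < M := by positivity
  have hpow : (1 + lam) ^ G.degree v ≤ M := pow_le_pow_right₀ (by linarith) hdeg
  have haM : a ≤ M * b := hstrip.trans (mul_le_mul_of_nonneg_right hpow hb)
  have htot : hardCoreZ G lam S' R = a + lam * b := by rw [hsplit, hocc]
  have key : a * (M + lam) ≤ M * (a + lam * b) := by nlinarith
  unfold vacancyRatio
  rw [← hM, htot, div_mul_eq_mul_div, le_div_iff₀ (by positivity)]
  linarith

/-- **Conditional vacancy decay (two-sided boundary condition).**  For a boundary condition `(Λ, R)`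
and every finite set `U` disjoint from `Λ`, all of whose vertices have degree `≤ Δ` and no occupied
boundary neighbour, `Z^{Λ ∪ U, R} ≤ ρ_Δ(λ)^{#U} · Z^{Λ, R}`: conditionally on the configuration `R` on
`Λ`, the vertices of `U` are all vacant with probability at most `ρ_Δ(λ)^{#U}`.
[cite: Weitz2006, §2 and Thm. 3.1 (proof) — iterated consequence supplied here] -/
theorem hardCoreZ_union_vacant_le_bc {lam : ℝ} (hlam : 0 < lam) {Δ : ℕ} {Λ R : Finset V} (hR : R ⊆ Λ) :
    ∀ U : Finset V, Disjoint U Λ → (∀ v ∈ U, G.degree v ≤ Δ) → (∀ v ∈ U, ¬ ∃ u ∈ R, G.Adj v u) →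
      hardCoreZ G lam (Λ ∪ U) R ≤ vacancyRatio Δ lam ^ U.card * hardCoreZ G lam Λ R := by
  intro U
  induction U using Finset.induction_on with
  | empty => intro _ _ _; simp
  | @insert v U' hv ih =>
    intro hdisj hdeg hadj
    have hdisj' : Disjoint U' Λ := (disjoint_insert_left.1 hdisj).2
    have hvΛ : v ∉ Λ := (disjoint_insert_left.1 hdisj).1
    have hv' : v ∉ Λ ∪ U' := by
      rw [mem_union, not_or]; exact ⟨hvΛ, hv⟩
    have h1 := hardCoreZ_insert_vacant_le_bc G hlam (S' := Λ ∪ U') (R := R) hv'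
      (hR.trans subset_union_left) (hadj v (mem_insert_self v U')) (hdeg v (mem_insert_self v U'))
    have h2 := ih hdisj' (fun u hu => hdeg u (mem_insert_of_mem hu)) (fun u hu => hadj u (mem_insert_of_mem hu))
    have hρ := vacancyRatio_nonneg Δ hlam.le
    rw [union_insert, card_insert_of_notMem hv, pow_succ]
    calc hardCoreZ G lam (insert v (Λ ∪ U')) R ≤ vacancyRatio Δ lam * hardCoreZ G lam (Λ ∪ U') R := h1
      _ ≤ vacancyRatio Δ lam * (vacancyRatio Δ lam ^ U'.card * hardCoreZ G lam Λ R) :=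
          mul_le_mul_of_nonneg_left h2 hρ
      _ = vacancyRatio Δ lam ^ U'.card * vacancyRatio Δ lam * hardCoreZ G lam Λ R := by ring

/-- The same for an ARBITRARY `U` disjoint from `Λ` (degrees `≤ Δ`): the exponent counts the vertices
of `U` with no occupied boundary neighbour (the others are vacant for free).
[cite: Weitz2006, §2 and Thm. 3.1 (proof) — iterated consequence supplied here] -/
theorem hardCoreZ_union_vacant_le_bc' {lam : ℝ} (hlam : 0 < lam) {Δ : ℕ} {Λ R : Finset V} (hR : R ⊆ Λ)
    (U : Finset V) (hdisj : Disjoint U Λ) (hdeg : ∀ v ∈ U, G.degree v ≤ Δ) :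
    hardCoreZ G lam (Λ ∪ U) R ≤
      vacancyRatio Δ lam ^ (U.filter fun v => ¬ ∃ u ∈ R, G.Adj v u).card * hardCoreZ G lam Λ R := by
  set U₀ := U.filter fun v => ¬ ∃ u ∈ R, G.Adj v u with hU₀
  have hsub : U₀ ⊆ U := filter_subset _ _
  have hmono : hardCoreZ G lam (Λ ∪ U) R ≤ hardCoreZ G lam (Λ ∪ U₀) R :=
    hardCoreZ_anti G hlam.le (union_subset_union (Subset.refl Λ) hsub) (hR.trans subset_union_left)
  refine hmono.trans (hardCoreZ_union_vacant_le_bc G hlam hR U₀ ?_ ?_ ?_)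
  · exact disjoint_of_subset_left hsub hdisj
  · exact fun v hv => hdeg v (hsub hv)
  · intro v hv; exact (mem_filter.1 hv).2

/-- **The cycle at fugacity 2, conditional form** (the two-sided Markov-type bound for the coin
process of the mod-3 ring game): under ANY boundary condition `(Λ, R)` on `C_N`, `N ≥ 3`, a set `U` of
further positions is vacant with conditional probability at most `(9/11)^{#U − #(u ∈ U adjacent to R)}`:
`Z^{Λ ∪ U, R} ≤ (9/11)^{#{u ∈ U : no neighbour in R}} · Z^{Λ, R}`.
[cite: Weitz2006, §2 and Thm. 3.1 (proof) — specialisation supplied here] -/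
theorem cycle_hardCoreZ_union_vacant_le_bc (n : ℕ) {Λ R : Finset (Fin (n + 3))} (hR : R ⊆ Λ)
    (U : Finset (Fin (n + 3))) (hdisj : Disjoint U Λ) :
    hardCoreZ (SimpleGraph.cycleGraph (n + 3)) 2 (Λ ∪ U) R ≤
      (9 / 11 : ℝ) ^ (U.filter fun v => ¬ ∃ u ∈ R, (SimpleGraph.cycleGraph (n + 3)).Adj v u).card *
        hardCoreZ (SimpleGraph.cycleGraph (n + 3)) 2 Λ R := by
  rw [← vacancyRatio_two_two]
  convert hardCoreZ_union_vacant_le_bc' (SimpleGraph.cycleGraph (n + 3)) (by norm_num : (0:ℝ) < 2) hR U hdisj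
    fun v _ => (SimpleGraph.cycleGraph_degree_three_le (v := v)).le using 7

/-! ### Two-sided single-site bounds

At a FREE vertex `v ∉ Λ ⊇ R` (`R` independent) the conditional occupation probability
`p_v = P(v ∈ I ∣ I ∩ Λ = R)` satisfies `p_v ≤ λ/(1+λ)` always (`p_v = ρ_v/(1+ρ_v)`, `ρ_v ≤ λ`:
`Weitz.hardCoreOccProb_eq_ratio`, `Weitz.ratio_le`), and `1 − ρ_Δ(λ) ≤ p_v` when no occupied boundary
vertex is adjacent to `v` and `deg v ≤ Δ` (`hardCoreZ_insert_vacant_le_bc`).  On the cycle at fugacity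
`2`: `2/11 ≤ p_v ≤ 2/3` whatever is prescribed at the other vertices (both ends attained: no / both
second neighbours occupied) — the «toggle both ways with probability ≥ c» bound of the cell's (W-c). -/

/-- **Upper single-site bound.**  For a free vertex `v ∉ Λ ⊇ R` (`R` independent, `λ > 0`):
`p_v ≤ λ/(1+λ)`.  [cite: Weitz2006, §2 and Thm. 3.1 (`p_v = R_v/(1+R_v)`, `R_v ≤ λ`) — consequence supplied here] -/
theorem hardCoreOccProb_le_activity_div {lam : ℝ} (hlam : 0 < lam) {Λ R : Finset V} {v : V}
    (hv : v ∉ Λ) (hR : R ⊆ Λ) (hind : G.IsIndepSet (R : Set V)) :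
    hardCoreOccProb G lam Λ R v ≤ lam / (1 + lam) := by
  rw [hardCoreOccProb_eq_ratio G hlam hv hR hind]
  set ρ := hardCoreZ G lam (insert v Λ) (insert v R) / hardCoreZ G lam (insert v Λ) R
  have hρ0 : 0 ≤ ρ := ratio_nonneg G hlam.le Λ R v
  have hρ : ρ ≤ lam := ratio_le G hlam hv hR hind
  rw [div_le_div_iff₀ (by positivity) (by positivity)]
  nlinarith

/-- **Lower single-site bound.**  For a free vertex `v ∉ Λ ⊇ R` (`R` independent, `λ > 0`) with no
occupied boundary neighbour and `deg v ≤ Δ`: `1 − ρ_Δ(λ) ≤ p_v`, i.e. `v` is VACANT with conditional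
probability at most `ρ_Δ(λ) = (1+λ)^Δ/((1+λ)^Δ + λ)`.
[cite: Weitz2006, §2 and Thm. 3.1 (proof; recursion for the occupation ratio) — consequence supplied here] -/
theorem one_sub_vacancyRatio_le_hardCoreOccProb {lam : ℝ} (hlam : 0 < lam) {Δ : ℕ}
    {Λ R : Finset V} {v : V} (hv : v ∉ Λ) (hR : R ⊆ Λ) (hind : G.IsIndepSet (R : Set V))
    (hadj : ¬ ∃ u ∈ R, G.Adj v u) (hdeg : G.degree v ≤ Δ) :
    1 - vacancyRatio Δ lam ≤ hardCoreOccProb G lam Λ R v := by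
  have hZ : 0 < hardCoreZ G lam Λ R := hardCoreZ_pos G hlam hR hind
  have hstep := hardCoreZ_insert_vacant_le_bc G hlam hv hR hadj hdeg
  rw [hardCoreOccProb_eq_div G hv hR, le_div_iff₀ hZ]
  rw [hardCoreZ_split G (lam := lam) hv hR] at hstep ⊢
  nlinarith [hstep, hardCoreZ_nonneg G hlam.le (insert v Λ) R,
    hardCoreZ_nonneg G hlam.le (insert v Λ) (insert v R), vacancyRatio_nonneg Δ hlam.le]

/-- **The cycle at fugacity 2, single site, two-sided**: under ANY boundary condition `(Λ, R)` on
`C_N` (`N ≥ 3`, `R ⊆ Λ` independent) a free position `v ∉ Λ` with no occupied prescribed neighbour is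
occupied with conditional probability in `[2/11, 2/3]` (`1 − 9/11 = 2/11`, `2/(1+2) = 2/3`).
[cite: Weitz2006, §2 and Thm. 3.1 (proof) — specialisation supplied here] -/
theorem cycle_hardCoreOccProb_mem_Icc (n : ℕ) {Λ R : Finset (Fin (n + 3))} {v : Fin (n + 3)}
    (hv : v ∉ Λ) (hR : R ⊆ Λ)
    (hind : (SimpleGraph.cycleGraph (n + 3)).IsIndepSet (R : Set (Fin (n + 3))))
    (hadj : ¬ ∃ u ∈ R, (SimpleGraph.cycleGraph (n + 3)).Adj v u) :
    hardCoreOccProb (SimpleGraph.cycleGraph (n + 3)) 2 Λ R v ∈ Set.Icc (2 / 11 : ℝ) (2 / 3) := by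
  refine ⟨?_, ?_⟩
  · have h := one_sub_vacancyRatio_le_hardCoreOccProb (SimpleGraph.cycleGraph (n + 3))
      (by norm_num : (0:ℝ) < 2) hv hR hind hadj (SimpleGraph.cycleGraph_degree_three_le (v := v)).le
    rw [vacancyRatio_two_two] at h
    linarith
  · have h := hardCoreOccProb_le_activity_div (SimpleGraph.cycleGraph (n + 3))
      (by norm_num : (0:ℝ) < 2) hv hR hind
    norm_num at h
    exact h

end Conditional

end HardCoreVacancy

end Literature.Probability.LatticeModels
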